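import Summits.CriticalPhenomena.PercolationContinuityZ3.Theorems.Transplant.PlanarSkeletonFrmScaledCoarse
import Summits.CriticalPhenomena.PercolationContinuityZ3.Theorems.Transplant.SkelPhiCylBall
import HarnessLib

/-!
# The coarse-chart dictionary of a one-type scaled skeleton, PART 4: **BASE-TYPE PROXIES** — every vertex `c` has, in its own coarse cell `⌊φ/N⌋`, within a
# bounded graph distance, a vertex `c′` of the BASE coarse type (an exact `⌊φ/N⌋`-frame image of `t`), and then `c` lies in the fat prisms of `c′`

builds on p205010 (kernel theorem, internal audit signed; external expert review pending) — nothing in this file uses p205010.  RULING D-s (c)/4 (lead g21,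
2026-08-26): coarse-chart GEOMETRY only; no node / statement / `@[conjecture]`; NOTHING about U_s (`SamePDropOfSkeletonFrmScaled₁`), U, (D-s2‴) as a proof, or the
end state is claimed — all OPEN.  Lane `prim-bschramm`, seat `prim-bschramm-p3` gen 26 (N2 design owner; class C2); helper file
(`--supports stmt-CriticalPhenomena-4575 --as helper`).  Def-free (existential packaging, as part 1's `exists_coarseTypes`).

WHY (P3-NILPOTENT §19.12, the design candidate of record (D-s2‴) for U_s, V147 amendment 1): the frames-only machinery run on the coarse chart `ψ = ⌊φ/N⌋`
serves its Step-I inputs at an arbitrary centre `c` through a base-type frame at `c`; with `≤ N²` residue types such a frame exists only at vertices of the base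
residue class.  This file supplies the geometric substitute: a PROXY `c′` of the base class in the same coarse cell, at graph distance `≤ D(Φ)`, so that `c` lies
in every fat prism `cylBall ψ c′ k R` with `k, R ≥ D(Φ)` (the seed floor `m₀ ≥ D(Φ)` of LEVEL 0‴).
* §1 integer arithmetic: the proxy offset `proxyOff N a b` of a coordinate `a` against the base coordinate `b` — `N ∣ a − b + proxyOff`, `(a + proxyOff)/N = a/N`,
  `|proxyOff| < N`;
* §2 exact `N`-step translates (`exists_φ_eq_add_Nmul`), the per-vertex offset `d(c)` realised by a vertex `u` with `φ u − φ t = d(c)` (`exists_offset_vertex`);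
* §3 **`exists_proxies`**: ONE radius `D` such that every `c` has `c′` and a fine frame `α : t ↦ c′` translating `φ` by an `N`-DIVISIBLE vector — hence translating
  `ψ` EXACTLY (`coarse_translate_of_dvd`) — with `ψ c′ = ψ c` and `c ∈ graphBall G c′ D`, `c′ ∈ graphBall G c D` (connected `G`);
* §4 `Skelφ.mem_cylBall_of_walk` (a `1`-Lipschitz chart keeps a walk of length `≤ min k R` from `x` inside `cylBall x k R`) and **`exists_proxies_cylBall`**
  (`L ≤ N`: `c ∈ Skelφ.cylBall G Φ.coarse c′ k R` for all `k, R ≥ D`).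
[cite: KozmaNitzan2024, §4 p. 15 (boxes and their translates), p. 16 (Lemma 8: the role of the lattice symmetries), pp. 19–21 ((21)–(25): the inputs at every vertex)]
[cite: BenjaminiSchramm1996, Conj. 4] [this work]
-/

noncomputable section

namespace Summit.CriticalPhenomena.PercolationContinuityZ3.Theorems.Transplant

open Literature.Probability.LatticeModels SimpleGraph
open Literature.Barriers.CriticalPhenomena (graphBall mem_graphBall_self graphBall_mono mem_graphBall_map)
open scoped Classical

namespace PlanarSkeletonFrmScaled

/-! ## §1 The proxy offset of one coordinate -/

/-- **The proxy offset** of a coordinate `a` against a base coordinate `b` modulo `N`: the unique `d ≡ b − a (mod N)` with `0 ≤ a mod N + d < N`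
(so adding `d` does not leave `a`'s residue cell and lands on `b`'s residue class). [folklore] -/
def proxyOff (N a b : ℤ) : ℤ := if a % N + (b - a) % N < N then (b - a) % N else (b - a) % N - N

/-- `N ∣ a − b + proxyOff N a b`. [folklore] -/
theorem dvd_proxyOff (N a b : ℤ) : N ∣ a - b + proxyOff N a b := by
  have h0 : N ∣ a - b + (b - a) % N := by
    have h1 : (b - a) % N = (b - a) - N * ((b - a) / N) := by rw [Int.emod_def]
    rw [h1]; exact ⟨-((b - a) / N), by ring⟩
  unfold proxyOff
  split_ifs
  · exact h0
  · have : a - b + ((b - a) % N - N) = (a - b + (b - a) % N) - N := by ring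
    rw [this]; exact dvd_sub h0 (dvd_refl N)

/-- `0 ≤ a mod N + proxyOff N a b < N`. [folklore] -/
theorem emod_add_proxyOff {N : ℤ} (hN : 0 < N) (a b : ℤ) : 0 ≤ a % N + proxyOff N a b ∧ a % N + proxyOff N a b < N := by
  have ha0 := Int.emod_nonneg a hN.ne'
  have ha1 := Int.emod_lt_of_pos a hN
  have hr0 := Int.emod_nonneg (b - a) hN.ne'
  have hr1 := Int.emod_lt_of_pos (b - a) hN
  unfold proxyOff
  split_ifs with h
  · exact ⟨by linarith, h⟩
  · have h' := not_lt.1 h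
    constructor <;> linarith

/-- **Adding the proxy offset does not change the cell**: `(a + proxyOff N a b)/N = a/N`. [folklore] -/
theorem ediv_add_proxyOff {N : ℤ} (hN : 0 < N) (a b : ℤ) : (a + proxyOff N a b) / N = a / N := by
  obtain ⟨h0, h1⟩ := emod_add_proxyOff hN a b
  have hdec : a + proxyOff N a b = (a % N + proxyOff N a b) + a / N * N := by
    have := Int.emod_add_ediv_mul a N; linarith
  rw [hdec, Int.add_mul_ediv_right _ _ hN.ne', Int.ediv_eq_zero_of_lt h0 h1, zero_add]

/-- `|proxyOff N a b| < N` (indeed `−N < proxyOff < N`). [folklore] -/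
theorem abs_proxyOff_lt {N : ℤ} (hN : 0 < N) (a b : ℤ) : |proxyOff N a b| < N := by
  have ha0 := Int.emod_nonneg a hN.ne'
  have ha1 := Int.emod_lt_of_pos a hN
  have hr0 := Int.emod_nonneg (b - a) hN.ne'
  have hr1 := Int.emod_lt_of_pos (b - a) hN
  unfold proxyOff
  split_ifs with h
  · rw [abs_lt]; constructor <;> linarith
  · have h' := not_lt.1 h
    rw [abs_lt]; constructor <;> linarith

variable {V : Type} {G : SimpleGraph V} [G.LocallyFinite] (Φ : PlanarSkeletonFrmScaled G)

/-! ## §2 Exact `N`-step translates; the offset of a vertex realised by a vertex -/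

/-- **A vertex over every `N`-multiple of a coordinate line** through `φ(v)` (field (ι_N), both signs). [cite: KozmaNitzan2024, §4 p. 26 ((29))] -/
theorem exists_φ_eq_add_Nmul (v : V) (i : Fin 2) (x : ℤ) : ∃ w, Φ.φ w = Φ.φ v + Pi.single i ((Φ.N : ℤ) * x) := by
  induction x using Int.induction_on with
  | zero => exact ⟨v, by simp⟩
  | succ n ih =>
    obtain ⟨w, hw⟩ := ih
    obtain ⟨w', -, hw'⟩ := Φ.step w i 1
    refine ⟨w', ?_⟩
    rw [hw', hw, Units.val_one, mul_one, add_assoc, ← Pi.single_add, mul_add, mul_one]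
  | pred n ih =>
    obtain ⟨w, hw⟩ := ih
    obtain ⟨w', -, hw'⟩ := Φ.step w i (-1)
    refine ⟨w', ?_⟩
    rw [hw', hw, Units.val_neg, Units.val_one, mul_neg_one, add_assoc, ← Pi.single_add, mul_sub, mul_one, sub_eq_add_neg]

/-- A vertex over every point of the lattice `φ(v) + N ℤ²`. [folklore] -/
theorem exists_φ_eq_add_Nvec (v : V) (z : Site 2) : ∃ w, Φ.φ w = Φ.φ v + fun i => (Φ.N : ℤ) * z i := by
  obtain ⟨w₀, hw₀⟩ := Φ.exists_φ_eq_add_Nmul v 0 (z 0)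
  obtain ⟨w₁, hw₁⟩ := Φ.exists_φ_eq_add_Nmul w₀ 1 (z 1)
  refine ⟨w₁, ?_⟩
  rw [hw₁, hw₀, add_assoc]
  congr 1
  funext i
  fin_cases i <;> simp

/-- **The proxy offset of a vertex** (against the base vertex `t`), coordinatewise. [this work] -/
def proxyVec (t c : V) : Site 2 := fun i => proxyOff (Φ.N : ℤ) (Φ.φ c i) (Φ.φ t i)

/-- The proxy offset of a vertex lies in the open box `(−N, N)²`, in particular in `box 2 N`. [folklore] -/
theorem proxyVec_mem_box (t c : V) : Φ.proxyVec t c ∈ box 2 Φ.N := by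
  rw [mem_box]
  intro i
  have h := abs_proxyOff_lt Φ.N_pos (Φ.φ c i) (Φ.φ t i)
  rw [abs_lt] at h
  exact ⟨by unfold proxyVec; linarith [h.1], by unfold proxyVec; linarith [h.2]⟩

/-- **The proxy offset is realised**: for a ONE-TYPE scaled skeleton and every vertex `c` there is a vertex `u` with `φ u − φ t = proxyVec t c` (invert the fine frame
`t ↦ c`, then walk exact `N`-steps). [cite: KozmaNitzan2024, §4 p. 15 (boxes and their translates)] -/
theorem exists_offset_vertex {t : V} (h1 : Φ.types = {t}) (c : V) : ∃ u : V, Φ.φ u - Φ.φ t = Φ.proxyVec t c := by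
  -- the inverse frame carries `t` to a vertex at fine offset `−(φ c − φ t)`
  obtain ⟨γ, -, hγ⟩ := Φ.exists_fineFrame h1 c t
  have hq : ∀ i, ∃ q : ℤ, (Φ.φ c i - Φ.φ t i) + Φ.proxyVec t c i = (Φ.N : ℤ) * q := fun i =>
    dvd_proxyOff (Φ.N : ℤ) (Φ.φ c i) (Φ.φ t i)
  choose q hq using hq
  obtain ⟨u, hu⟩ := Φ.exists_φ_eq_add_Nvec (γ t) (fun i => q i)
  refine ⟨u, ?_⟩
  funext i
  rw [Pi.sub_apply, hu, Pi.add_apply, hγ t, Pi.add_apply, Pi.sub_apply]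
  have := hq i
  linarith

/-! ## §3 Base-type proxies: same coarse cell, bounded graph distance, exact coarse frame -/

/-- **BASE-TYPE PROXIES.**  For a connected graph with a ONE-TYPE scaled skeleton there is a radius `D` such that EVERY vertex `c` has a PROXY `c′` with a fine frame
`α : t ↦ c′` translating `φ` by the `N`-DIVISIBLE vector `φ c′ − φ t` — hence translating the coarse chart `⌊φ/N⌋` EXACTLY by `⌊φ c′/N⌋ − ⌊φ t/N⌋` —, lying in the SAME
coarse cell as `c` (`⌊φ c′/N⌋ = ⌊φ c/N⌋`), and within graph distance `D` of `c` (both ways).  (`D` = the largest distance from `t` to a chosen realiser of one of the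
`≤ (2N−1)²` proxy offsets; `c′ := α_c u` for the fine frame `α_c : t ↦ c` and the realiser `u` of `c`'s offset.)
[cite: KozmaNitzan2024, §4 p. 15 (boxes and their translates), pp. 19–21 ((21)–(25))] [this work] -/
theorem exists_proxies (hc : G.Connected) {t : V} (h1 : Φ.types = {t}) :
    ∃ D : ℕ, ∀ c : V, ∃ (c' : V) (α : G ≃g G), α t = c' ∧ (∀ w, Φ.φ (α w) = Φ.φ w + (Φ.φ c' - Φ.φ t)) ∧
      (∀ i, (Φ.N : ℤ) ∣ (Φ.φ c' - Φ.φ t) i) ∧ (∀ w, Φ.coarse (α w) = Φ.coarse w + (Φ.coarse c' - Φ.coarse t)) ∧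
      Φ.coarse c' = Φ.coarse c ∧ c ∈ graphBall G c' D ∧ c' ∈ graphBall G c D := by
  have hN := Φ.N_pos
  -- one realiser per offset in the finite box, with a walk from `t`
  have hreal : ∀ d : Site 2, ∃ (u : V) (n : ℕ), ((∃ c, Φ.proxyVec t c = d) → Φ.φ u - Φ.φ t = d) ∧ u ∈ graphBall G t n := by
    intro d
    by_cases hd : ∃ c, Φ.proxyVec t c = d
    · obtain ⟨c, hcd⟩ := hd
      obtain ⟨u, hu⟩ := Φ.exists_offset_vertex h1 c
      obtain ⟨w⟩ := hc.preconnected t u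
      exact ⟨u, w.length, fun _ => by rw [hu, hcd], ⟨w, le_rfl⟩⟩
    · exact ⟨t, 0, fun h => absurd h hd, mem_graphBall_self G t 0⟩
  choose u n hu hun using hreal
  -- the radius: the largest walk length over the finite box of offsets
  set B : Finset (Site 2) := Fintype.piFinset fun _ : Fin 2 => Finset.Icc (-(Φ.N : ℤ)) Φ.N with hB
  have hmemB : ∀ c, Φ.proxyVec t c ∈ B := fun c => by
    rw [hB, Fintype.mem_piFinset]
    intro i
    rw [Finset.mem_Icc]
    exact (mem_box.1 (Φ.proxyVec_mem_box t c)) i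
  refine ⟨B.sup n, fun c => ?_⟩
  set d := Φ.proxyVec t c with hd
  -- the fine frame `t ↦ c` and the proxy `c′ := α_c (u d)`
  obtain ⟨αc, hαct, hαc⟩ := Φ.exists_fineFrame h1 t c
  set c' : V := αc (u d) with hc'
  have hud : Φ.φ (u d) - Φ.φ t = d := hu d ⟨c, hd.symm⟩
  have hφc' : Φ.φ c' = Φ.φ c + d := by
    rw [hc', hαc (u d)]
    have : Φ.φ (u d) = Φ.φ t + d := sub_eq_iff_eq_add'.1 hud
    rw [this]; abel
  -- (p1) N-divisibility of `φ c′ − φ t`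
  have hdvd : ∀ i, (Φ.N : ℤ) ∣ (Φ.φ c' - Φ.φ t) i := by
    intro i
    rw [Pi.sub_apply, hφc', Pi.add_apply]
    have := dvd_proxyOff (Φ.N : ℤ) (Φ.φ c i) (Φ.φ t i)
    have e : Φ.φ c i + d i - Φ.φ t i = Φ.φ c i - Φ.φ t i + proxyOff (Φ.N : ℤ) (Φ.φ c i) (Φ.φ t i) := by rw [hd]; unfold proxyVec; ring
    rw [e]; exact this
  -- the fine frame `t ↦ c′`
  obtain ⟨α, hαt, hα⟩ := Φ.exists_fineFrame h1 t c'
  -- (p2) same coarse cell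
  have hcell : Φ.coarse c' = Φ.coarse c := by
    funext i
    rw [coarse_apply, coarse_apply, hφc', Pi.add_apply, hd]
    exact ediv_add_proxyOff hN (Φ.φ c i) (Φ.φ t i)
  -- exact coarse translation by the frame `α`
  have hcoarse : ∀ w, Φ.coarse (α w) = Φ.coarse w + (Φ.coarse c' - Φ.coarse t) := by
    intro w
    rw [Φ.coarse_translate_of_dvd hα hdvd w]
    congr 1
    funext i
    obtain ⟨q, hq⟩ := hdvd i
    rw [Pi.sub_apply] at hq
    have hv : Φ.φ c' i = Φ.φ t i + q * (Φ.N : ℤ) := by linarith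
    rw [Pi.sub_apply, Pi.sub_apply, hq, Int.mul_ediv_cancel_left _ hN.ne', coarse_apply, coarse_apply, hv, Int.add_mul_ediv_right _ _ hN.ne']
    ring
  -- (p3) graph distance both ways: `c′ = α_c (u d)`, `c = α_c t`, and `u d ∈ graphBall t (n d)`
  have hnD : n d ≤ B.sup n := Finset.le_sup (f := n) (hmemB c)
  have hcc' : c' ∈ graphBall G c (B.sup n) := by
    have h := mem_graphBall_map αc (hun d)
    rw [hαct] at h
    exact graphBall_mono G c hnD h
  have hc'c : c ∈ graphBall G c' (B.sup n) := by
    obtain ⟨w', hw'⟩ := hcc'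
    exact ⟨w'.reverse, by rw [SimpleGraph.Walk.length_reverse]; exact hw'⟩
  exact ⟨c', α, hαt, hα, hdvd, hcoarse, hcell, hc'c, hcc'⟩

end PlanarSkeletonFrmScaled

/-! ## §4 Walks inside fat prisms; the proxy's fat prisms contain the vertex -/

namespace Skelφ

variable {V : Type} {G : SimpleGraph V} {ψ : V → Site 2}

/-- **A `1`-Lipschitz chart keeps short walks inside fat prisms**: if `w` is a walk from `y` to `x` of length `≤ k`, then `y ∈ cylBall G ψ x k w.length`
(the walk stays in the cylinder of half-width `k` about `x` because each step moves `ψ` by at most one). [folklore] -/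
theorem mem_cylBall_of_walk (hlip : Lip G ψ) {x : V} {k : ℕ} : ∀ {y : V} (w : G.Walk y x), w.length ≤ k → y ∈ cylBall G ψ x k w.length := by
  intro y w
  induction w with
  | nil => intro _; exact self_mem_cylBall G ψ _ k 0
  | @cons y v x h p ih =>
    intro hlen
    rw [SimpleGraph.Walk.length_cons] at hlen ⊢
    have hv : v ∈ cylBall G ψ x k p.length := ih (by omega)
    have hy : y ∈ cyl ψ x k := by
      rw [mem_cyl, mem_box]
      intro i
      have h1 := abs_sub_le_length hlip (SimpleGraph.Walk.cons h p) i
      rw [SimpleGraph.Walk.length_cons, abs_sub_comm] at h1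
      rw [Pi.sub_apply]
      have h2 : ((p.length + 1 : ℕ) : ℤ) ≤ k := by exact_mod_cast hlen
      constructor <;> linarith [(abs_le.1 (h1.trans h2)).1, (abs_le.1 (h1.trans h2)).2]
    exact mem_cylBall_succ_of_adj G ψ x le_rfl hv h.symm hy

/-- Hence: a vertex within graph distance `D ≤ min k R` of `x` lies in `cylBall G ψ x k R`. [folklore] -/
theorem mem_cylBall_of_mem_graphBall (hlip : Lip G ψ) {x y : V} {D k R : ℕ} (hy : y ∈ graphBall G x D) (hk : D ≤ k) (hR : D ≤ R) :
    y ∈ cylBall G ψ x k R := by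
  obtain ⟨w, hw⟩ := hy
  have h := mem_cylBall_of_walk (k := k) hlip w.reverse (by rw [SimpleGraph.Walk.length_reverse]; omega)
  rw [SimpleGraph.Walk.length_reverse] at h
  exact cylBall_mono G ψ x le_rfl (hw.trans hR) h

end Skelφ

namespace PlanarSkeletonFrmScaled

variable {V : Type} {G : SimpleGraph V} [G.LocallyFinite] (Φ : PlanarSkeletonFrmScaled G)

/-- **PROXIES AND FAT PRISMS** (`L ≤ N`, so the coarse chart is `1`-Lipschitz): with the radius `D` of `exists_proxies`, every vertex `c` lies in every fat prism
`Skelφ.cylBall G ⌊φ/N⌋ c′ k R` of its proxy `c′` with `k, R ≥ D` — in particular in the LEVEL-0 seed `fatSeq c′ k` once the seed level is `≥ D` (`le_fatRadius`).  This is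
the (p4) of P3-NILPOTENT §19.12: 'the current cluster contains `c`' implies 'the current cluster meets the seed of `c′`'. [cite: KozmaNitzan2024, §4 pp. 19–21] [this work] -/
theorem exists_proxies_cylBall (hc : G.Connected) {t : V} (h1 : Φ.types = {t}) (hLN : Φ.L ≤ Φ.N) :
    ∃ D : ℕ, ∀ c : V, ∃ (c' : V) (α : G ≃g G), α t = c' ∧ (∀ w, Φ.coarse (α w) = Φ.coarse w + (Φ.coarse c' - Φ.coarse t)) ∧
      Φ.coarse c' = Φ.coarse c ∧ c ∈ graphBall G c' D ∧
      ∀ k R : ℕ, D ≤ k → D ≤ R → c ∈ Skelφ.cylBall G Φ.coarse c' k R := by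
  obtain ⟨D, hD⟩ := Φ.exists_proxies hc h1
  refine ⟨D, fun c => ?_⟩
  obtain ⟨c', α, hαt, -, -, hcoarse, hcell, hcD, -⟩ := hD c
  exact ⟨c', α, hαt, hcoarse, hcell, hcD, fun k R hk hR => Skelφ.mem_cylBall_of_mem_graphBall (Φ.coarse_lip hLN) hcD hk hR⟩

end PlanarSkeletonFrmScaled

end Summit.CriticalPhenomena.PercolationContinuityZ3.Theorems.Transplant

end
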